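/-
Copyright (c) 2026 the pub-hodgecm-mathlib formalisation cell (harness21).  Prover seat hodgecm-mathlib-F0P2-p07 (g2): Track B «K2-LIT»,
hLiu418 = stmt-HodgeConjecture-24832; (σ-A) road desk K2Liu-p25 (g4) WORD #13 (1) «(B2-coord) FILE B cut, B-1 → F0P2-p07» (SPEC
`K2/K2Liu-p12/g6/SPEC-B2coord-FILE-B.K2Liu-p12-g6.md` steps (S1)+(S2)); consumer B-2 `K2LiuConeGraphReadingPoint` (K2Liu-p12 ∕ K2Liu-p08 (g7)).
-/
import Summits.HodgeConjecture.HodgeConjecture.Theorems.K2LiuNormalisedCayleyReading   -- ★ p865154: the NORMALISED Cayley mover read backwards, ★ (C3-c) package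
import Mathlib.Data.Matrix.PEquiv
import HarnessLib

/-!
# Crux `HLiu418`, #42S block D row D-2, (B2-coord) FILE B-1: THE TWO-BLOCK POINT `PD · (z₁ ⊔ z₂)` THROUGH `E′⁻¹` AND `e_D⁻¹`, AT THE NORMALISED PAIR —
# `e_D⁻¹ (E′⁻¹ (PD · (z₁ ⊔ z₂), 0)) = adblV b`, `b = (z₁-reading ⊔ z₂-reading) ∘ σ` EXPLICIT

Cell `hodgecm-mathlib`, crux item hLiu418 = `stmt-HodgeConjecture-24832`; squad K2 ∕ K2Liu; prover F0P2-p07 (g2).  THEOREMS ONLY (no `def`, no instance,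
no notation, no named-fact hypothesis, no `sorry`); lane `--supports stmt-HodgeConjecture-24832 --as helper` (count-neutral helper).

WHY.  The (σ-A) ζ-stage's graph reading (B) (`K2LiuConeGraphReadingPoint`, SPEC (S3)–(S5)) acts with `ι(h)`, `h = p₀⁻¹ ⊗ 1`, on the point
`E′⁻¹ (PD · (x₁ ⊔ 0), 0)` of ★ (C3-c) and must come back through `E′` at a TWO-block point `PD · (y₁ ⊔ y₂)` (`y₂ = λ • x₁ ≠ 0`).  This file is the
coordinate half (S1)+(S2): (S1) ★ (C3-c) `toLin_inv_frameMp_boxLoc_apply` GENERALISED from `x₁ ⊔ 0` to `z₁ ⊔ z₂` — `E′ = π(frameMp_{PD} j̃(p₁,p₂)) =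
frameW_{PD} ∘ (π(p₁) ⊞ π(p₂)) ∘ frameW_{PD}⁻¹`, so `E′⁻¹ (PD · (z₁ ⊔ z₂), 0) = frameW_{PD} (u₁.1 ⊔ u₂.1, u₁.2 ⊔ u₂.2)`, `uᵢ = π(pᵢ)⁻¹ (zᵢ, 0)`; (S2) at the
NORMALISED pair `π(p̂ᵢ) = transportSp 𝕋ᵢ (m(Aᵢ) · κᵢ)` (ruling (N); ★ p865154: `π(p̂ᵢ)⁻¹ (z, 0) = ((z¹ ⊔ −z¹), (z² ⊔ −z²))`, the `Tᵢ` CANCEL) the FULL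
`E ⊗ L⁺_v`-coordinate vector: `e_D⁻¹` of a `frameW_{PD}`-image is `P` acting on both `Δ`-halves (§1 `eD_symm_frameW_pd`, ★ `resL_resR_frameLin_pd`), `e_D⁻¹` of a
block point is the block gluing (§1 `eD_symm_glue`), `e_D⁻¹` of the anti-diagonal point is `adblV` of the PLAIN reading `zˡ ↦ ι(z_{inl l}) + ι(z_{inr l})·δ̂`
(§1 `eD_symm_antidiag`), and `P = σ.toPEquiv.toMatrix` permutes (`hPσ`):
**`e_D⁻¹ (E′⁻¹ (PD · (z₁ ⊔ z₂), 0)) = adblV (fun k ↦ (R z₁ ⊔ R z₂) (σ k))`** (§2 `eD_symm_toLin_inv_frameMp_boxLoc_apply_glue`), with the row reading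
`(R z₁ ⊔ R z₂) (σ (epsV (j, l))) = if j = i₀ then R z₁ l else R z₂ l` (§2 `glue_reading_apply_sigma_epsV`).  No `halfSum`∕`halfDiff` split is needed: the
vector is anti-diagonal on the nose.
HONEST LABEL.  Count-neutral helper: `HC_CM` is proved only modulo the 7 printed citations (2 remaining named inputs: hLiu418 = `stmt-HodgeConjecture-24832`,
h413 = `stmt-HodgeConjecture-24833`) until rung 0 closes.

## References
* [Kudla1994] S. S. Kudla, Israel J. Math. 87 (1994), §2, §3 Thm. 3.1.   * [Weil1964] A. Weil, Acta Math. 111 (1964), n° 34.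
* [MoeglinVignerasWaldspurger1987] C. Mœglin, M.-F. Vignéras, J.-L. Waldspurger, LNM 1291 (1987), Chap. 2 II.1 Rem. (6), II Remarque (3).
* [HarrisKudlaSweet1996] M. Harris, S. Kudla, W. J. Sweet, J. Amer. Math. Soc. 9 (1996), §1 (1.11).
-/

set_option autoImplicit false
set_option linter.dupNamespace false -- the mandated namespace repeats `HodgeConjecture.HodgeConjecture`

noncomputable section

open scoped Matrix
open NumberField IsDedekindDomain Matrix
open Literature.RepresentationTheory.HeisenbergGroup Literature.RepresentationTheory.HeisenbergGroup.SymplecticMatrix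
open Literature.NumberTheory.Automorphic Literature.NumberTheory.Automorphic.UnitaryGroup Literature.NumberTheory.Weil1964
open Literature.NumberTheory.GaloisRepresentations Literature.NumberTheory.GaloisRepresentations.IsNonarchimedeanLocalField
open Literature.NumberTheory.GelbartRogawski1991 Literature.NumberTheory.GelbartRogawski1991.GRConstruction
open Literature.NumberTheory.GelbartRogawski1991.AdaptedBlocks
open Literature.NumberTheory.GelbartRogawski1991.UnitaryDualPair
open Literature.NumberTheory.GelbartRogawski1991.UnitaryDualPair.LocalSplitting
open Literature.NumberTheory.GelbartRogawski1991.UnitaryDualPair.LocalSplitting.FrameTransport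
open Literature.NumberTheory.GelbartRogawski1991.UnitaryDualPair.LocalSplitting.DoubledBlock
open Literature.NumberTheory.K2Lit.SiegelDoubled
open Summit.HodgeConjecture.HodgeConjecture.Cruxes.HLiu418.K2LiuLocalSWTensorBlockTransport
open Summit.HodgeConjecture.HodgeConjecture.Cruxes.HLiu418.K2LiuTensorMiddleCellPointReading
open Summit.HodgeConjecture.HodgeConjecture.Cruxes.HLiu418.K2LiuNormalisedCayleyReading (transportSp_levi_mul_cayley_symm_apply)

namespace Summit.HodgeConjecture.HodgeConjecture.Cruxes.HLiu418.K2LiuConeGraphReadingPointTwoBlock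

/-! ## §1 `e_D⁻¹` of a frame image, of a block point, of the anti-diagonal point (generic doubled datum) -/

section Generic

variable (F : Type) [Field F] [NumberField F] (E : Type) [Field E] [NumberField E] [Algebra F E] [Algebra.IsQuadraticExtension F E]
  (c : E ≃ₐ[F] E) {δ : E} (hcδ : c δ = -δ) (hδ : δ ≠ 0) {d : F} (hd : δ * δ = algebraMap F E d)
  (v : HeightOneSpectrum (𝓞 F))

/-- gluing commutes with negation. [cite: Kudla1994, §2] -/
theorem glue_neg {X : Type*} [Neg X] {ι₁ ι₂ ι : Type*} (e : ι₁ ⊕ ι₂ ≃ ι) (a : ι₁ → X) (b : ι₂ → X) :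
    glue e (fun i => -a i) (fun j => -b j) = fun k => -glue e a b k := by
  funext k
  obtain ⟨s, rfl⟩ := e.surjective k
  rcases s with i | j
  · rw [glue_apply_inl, glue_apply_inl]
  · rw [glue_apply_inr, glue_apply_inr]

/-- **THE DOUBLED FRAME ACTS ON `e_D⁻¹` BY `P` ON BOTH HALVES**: for `PD = P ⊕ P` and `w ∈ 𝕎^𝔻_v`, `e_D⁻¹(frameW_{PD} w) = (P · (e_D⁻¹ w)|_L, P · (e_D⁻¹ w)|_R)`
(`P` read over `E ⊗ F_v`; ★ `resL_resR_frameLin_pd`: the `e₂`-halves of `PD · u` are `P · u|_L`, `P · u|_R`).  The `halfDiff` shadow is ★ (C3-c)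
`halfDiff_eD_symm_frameW_pd`. [cite: Weil1964, n° 34] [cite: HarrisKudlaSweet1996, §1 (1.11)] -/
theorem eD_symm_frameW_pd (n : ℕ) (P : GL (Fin n) F) {PD : GL (Fin (n + n)) F}
    (hPD : PD = UnitaryGroup.reindexGL (e₂ n) (UnitaryGroup.blockDiagGL (P, P)))
    (w : (Fin (n + n) → v.adicCompletion F) × (Fin (n + n) → v.adicCompletion F)) :
    (eD F E c hcδ hδ hd v n).symm (frameW F v (n + n) PD w) =
      Sum.elim
        (((P : Matrix (Fin n) (Fin n) F).map ((UnitaryGroup.toLocalRing E v).comp (algebraMap F (v.adicCompletion F)))) *ᵥ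
          fun i => (eD F E c hcδ hδ hd v n).symm w (Sum.inl i))
        (((P : Matrix (Fin n) (Fin n) F).map ((UnitaryGroup.toLocalRing E v).comp (algebraMap F (v.adicCompletion F)))) *ᵥ
          fun i => (eD F E c hcδ hδ hd v n).symm w (Sum.inr i)) := by
  funext s
  have h1 := resL_resR_frameLin_pd F v n P hPD w.1
  have h2 := resL_resR_frameLin_pd F v n P hPD w.2
  rcases s with i | i
  · have a1 : (frameW F v (n + n) PD w).1 (e₂ n (Sum.inl i)) = ∑ j, algebraMap F (v.adicCompletion F) (P i j) * w.1 (e₂ n (Sum.inl j)) := by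
      have h := congrFun h1.1 i
      simp only [resL, frameLin_apply, Matrix.mulVec, dotProduct, Matrix.map_apply] at h
      rw [frameW_apply]; exact h
    have a3 : (frameW F v (n + n) PD w).2 (e₂ n (Sum.inl i)) = ∑ j, algebraMap F (v.adicCompletion F) (P i j) * w.2 (e₂ n (Sum.inl j)) := by
      have h := congrFun h2.1 i
      simp only [resL, frameLin_apply, Matrix.mulVec, dotProduct, Matrix.map_apply] at h
      rw [frameW_apply]; exact h
    rw [Sum.elim_inl, eD_symm_apply, a1, a3, Matrix.mulVec, dotProduct]
    simp only [map_sum, map_mul, Matrix.map_apply, RingHom.comp_apply, eD_symm_apply, mul_add, Finset.sum_add_distrib,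
      Finset.sum_mul, mul_assoc]
  · have a2 : (frameW F v (n + n) PD w).1 (e₂ n (Sum.inr i)) = ∑ j, algebraMap F (v.adicCompletion F) (P i j) * w.1 (e₂ n (Sum.inr j)) := by
      have h := congrFun h1.2 i
      simp only [resR, frameLin_apply, Matrix.mulVec, dotProduct, Matrix.map_apply] at h
      rw [frameW_apply]; exact h
    have a4 : (frameW F v (n + n) PD w).2 (e₂ n (Sum.inr i)) = ∑ j, algebraMap F (v.adicCompletion F) (P i j) * w.2 (e₂ n (Sum.inr j)) := by
      have h := congrFun h2.2 i
      simp only [resR, frameLin_apply, Matrix.mulVec, dotProduct, Matrix.map_apply] at h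
      rw [frameW_apply]; exact h
    rw [Sum.elim_inr, eD_symm_apply, a2, a4, Matrix.mulVec, dotProduct]
    simp only [map_sum, map_mul, Matrix.map_apply, RingHom.comp_apply, eD_symm_apply, mul_add, Finset.sum_add_distrib,
      Finset.sum_mul, mul_assoc]

/-- **BLOCK POINTS READ BLOCKWISE (full vector)**: `e_D⁻¹(x₁ ⊔ x₂, y₁ ⊔ y₂) = ((e_D⁻¹(x₁,y₁))|_L ⊔ (e_D⁻¹(x₂,y₂))|_L, (e_D⁻¹(x₁,y₁))|_R ⊔ (e_D⁻¹(x₂,y₂))|_R)`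
along Kudla's index shuffle `blkIdx` and `finSumFinEquiv`; the `halfDiff` shadow is ★ (C3-c) `halfDiff_eD_symm_glue`. [cite: Kudla1994, §2]
[cite: MoeglinVignerasWaldspurger1987, Chap. 2 II.1 Rem. (6)] -/
theorem eD_symm_glue (n₁ n₂ : ℕ) (x₁ y₁ : Fin (n₁ + n₁) → v.adicCompletion F) (x₂ y₂ : Fin (n₂ + n₂) → v.adicCompletion F) :
    (eD F E c hcδ hδ hd v (n₁ + n₂)).symm (glue (blkIdx n₁ n₂) x₁ x₂, glue (blkIdx n₁ n₂) y₁ y₂) =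
      Sum.elim
        (glue finSumFinEquiv (fun i => (eD F E c hcδ hδ hd v n₁).symm (x₁, y₁) (Sum.inl i))
          (fun i => (eD F E c hcδ hδ hd v n₂).symm (x₂, y₂) (Sum.inl i)))
        (glue finSumFinEquiv (fun i => (eD F E c hcδ hδ hd v n₁).symm (x₁, y₁) (Sum.inr i))
          (fun i => (eD F E c hcδ hδ hd v n₂).symm (x₂, y₂) (Sum.inr i))) := by
  funext s
  rcases s with j | j
  · obtain ⟨t, rfl⟩ := finSumFinEquiv.surjective j
    rcases t with k | k
    · rw [Sum.elim_inl, glue_apply_inl, eD_symm_apply, eD_symm_apply]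
      simp only [← blkIdx_inl_inl, glue_apply_inl]
    · rw [Sum.elim_inl, glue_apply_inr, eD_symm_apply, eD_symm_apply]
      simp only [← blkIdx_inr_inl, glue_apply_inr]
  · obtain ⟨t, rfl⟩ := finSumFinEquiv.surjective j
    rcases t with k | k
    · rw [Sum.elim_inr, glue_apply_inl, eD_symm_apply, eD_symm_apply]
      simp only [← blkIdx_inl_inr, glue_apply_inl]
    · rw [Sum.elim_inr, glue_apply_inr, eD_symm_apply, eD_symm_apply]
      simp only [← blkIdx_inr_inr, glue_apply_inr]

/-- **`e_D⁻¹` OF THE ANTI-DIAGONAL POINT IS `adblV` OF THE PLAIN READING**: `e_D⁻¹ ((x¹ ⊔ −x¹), (x² ⊔ −x²)) = adblV (i ↦ ι_v(x¹ᵢ) + ι_v(x²ᵢ) · δ̂)`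
(`x = x¹ ⊔ x²` along `e₂`) — the point ★ p865154 `transportSp_levi_mul_cayley_symm_apply` produces. [cite: HarrisKudlaSweet1996, §1 (1.11)] [cite: Kudla1994, §3] -/
theorem eD_symm_antidiag (n : ℕ) (x : Fin (n + n) → v.adicCompletion F) :
    (eD F E c hcδ hδ hd v n).symm
        ((Sum.elim (fun i => x (e₂ n (Sum.inl i))) (fun i => -x (e₂ n (Sum.inl i)))) ∘ (e₂ n).symm,
          (Sum.elim (fun i => x (e₂ n (Sum.inr i))) (fun i => -x (e₂ n (Sum.inr i)))) ∘ (e₂ n).symm) =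
      adblV fun i => UnitaryGroup.toLocalRing E v (x (e₂ n (Sum.inl i))) +
        UnitaryGroup.toLocalRing E v (x (e₂ n (Sum.inr i))) * algebraMap E (LocalRing E v) δ := by
  funext s
  rcases s with i | i
  · rw [eD_symm_apply]
    simp only [adblV, Sum.elim_inl, Function.comp_apply, Equiv.symm_apply_apply]
  · rw [eD_symm_apply]
    simp only [adblV, Sum.elim_inr, Function.comp_apply, Equiv.symm_apply_apply, Pi.neg_apply, map_neg, neg_mul, neg_add]

end Generic

/-! ## §2 The tensor datum `𝕍 ⊗ V′`: the two-block point through `E′ = π(frameMp_{PD} j̃(p₁, p₂))`, and its `e_D⁻¹` at the normalised pair -/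

section Tensor

variable (L : Type) [Field L] [NumberField L] [IsCMField L]
variable {N M : ℕ} (e : Fin N × Fin M ≃ Fin 2)
  (dV : Fin N → L) (hdV : ∀ i, IsCMField.complexConj L (dV i) = dV i)
  (dW : Fin M → L) (hdW : ∀ i, IsCMField.complexConj L (dW i) = dW i)
variable {M₂ M' : ℕ} (eW : Fin M × Fin M₂ ≃ Fin M') (e' : Fin N × Fin M' ≃ Fin (M₂ + M₂))
  (dV' : Fin M₂ → L) (hdV' : ∀ k, IsCMField.complexConj L (dV' k) = dV' k)
  (v : HeightOneSpectrum (𝓞 (Fp L)))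

set_option maxHeartbeats 2000000 in -- MEASURED 2026-09-05: 800 000 ∕ 1 000 000 ✗ (`isDefEq` on the `MpPsi (localSchrodinger …)` ∕ `frameMp` letters — ★ (C3-c)'s 800k class, second block now live), 2 000 000 ✓
/-- **(S1) THE TWO-BLOCK POINT THROUGH `E′⁻¹`**: for `E′ = π(frameMp_{PD} j̃(p₁, p₂)) = frameW_{PD} ∘ (π(p₁) ⊞ π(p₂)) ∘ frameW_{PD}⁻¹` and ANY `z₁, z₂`,
`E′⁻¹ (PD · (z₁ ⊔ z₂), 0) = frameW_{PD} (u₁.1 ⊔ u₂.1, u₁.2 ⊔ u₂.2)`, `uᵢ = π(pᵢ)⁻¹ (zᵢ, 0)` — ★ (C3-c) `toLin_inv_frameMp_boxLoc_apply` is the case `z₂ = 0`.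
[cite: MoeglinVignerasWaldspurger1987, Chap. 2 II.1 Rem. (6), II Remarque (3)] [cite: Kudla1994, §2] -/
theorem toLin_inv_frameMp_boxLoc_apply_glue {T₁ T₂ : Matrix (Fin M₂) (Fin M₂) (Fp L)} (P : GL (Fin (M₂ + M₂)) (Fp L))
    (hP : ((P : Matrix (Fin (M₂ + M₂)) (Fin (M₂ + M₂)) (Fp L)))ᵀ *
        gramR L e' dV hdV (tensorFrame L dW eW dV') (tensorFrame_real L dW hdW eW dV' hdV') * (P : Matrix _ _ (Fp L)) =
      UnitaryGroup.finSum M₂ M₂ T₁ T₂)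
    {PD : GL (Fin ((M₂ + M₂) + (M₂ + M₂))) (Fp L)} (hPD : PD = UnitaryGroup.reindexGL (e₂ (M₂ + M₂)) (UnitaryGroup.blockDiagGL (P, P)))
    (p₁ : LocalMp (Fp L) (M₂ + M₂) (gramD (Fp L) M₂ T₁) v) (p₂ : LocalMp (Fp L) (M₂ + M₂) (gramD (Fp L) M₂ T₂) v)
    (z₁ z₂ : Fin (M₂ + M₂) → v.adicCompletion (Fp L)) :
    toLin (Fp L) v (MpPsi.proj _ (frameMp (Fp L) v ((M₂ + M₂) + (M₂ + M₂)) PD (transpose_pd_mul_gramD_mul_pd (Fp L) (M₂ + M₂) P hP hPD)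
        (boxLoc (Fp L) v M₂ M₂ (T₁ := T₁) (T₂ := T₂) (p₁, p₂))))⁻¹
      (frameLin (Fp L) v ((M₂ + M₂) + (M₂ + M₂)) PD (glue (blkIdx M₂ M₂) z₁ z₂), 0) =
    frameW (Fp L) v ((M₂ + M₂) + (M₂ + M₂)) PD
      (glue (blkIdx M₂ M₂)
          (((MpPsi.proj _ p₁ : LocalSp (Fp L) (M₂ + M₂) (gramD (Fp L) M₂ T₁) v) :
              ((Fin (M₂ + M₂) → v.adicCompletion (Fp L)) × (Fin (M₂ + M₂) → v.adicCompletion (Fp L))) ≃ₗ[v.adicCompletion (Fp L)]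
                ((Fin (M₂ + M₂) → v.adicCompletion (Fp L)) × (Fin (M₂ + M₂) → v.adicCompletion (Fp L)))).symm (z₁, 0)).1
          (((MpPsi.proj _ p₂ : LocalSp (Fp L) (M₂ + M₂) (gramD (Fp L) M₂ T₂) v) :
              ((Fin (M₂ + M₂) → v.adicCompletion (Fp L)) × (Fin (M₂ + M₂) → v.adicCompletion (Fp L))) ≃ₗ[v.adicCompletion (Fp L)]
                ((Fin (M₂ + M₂) → v.adicCompletion (Fp L)) × (Fin (M₂ + M₂) → v.adicCompletion (Fp L)))).symm (z₂, 0)).1,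
        glue (blkIdx M₂ M₂)
          (((MpPsi.proj _ p₁ : LocalSp (Fp L) (M₂ + M₂) (gramD (Fp L) M₂ T₁) v) :
              ((Fin (M₂ + M₂) → v.adicCompletion (Fp L)) × (Fin (M₂ + M₂) → v.adicCompletion (Fp L))) ≃ₗ[v.adicCompletion (Fp L)]
                ((Fin (M₂ + M₂) → v.adicCompletion (Fp L)) × (Fin (M₂ + M₂) → v.adicCompletion (Fp L)))).symm (z₁, 0)).2
          (((MpPsi.proj _ p₂ : LocalSp (Fp L) (M₂ + M₂) (gramD (Fp L) M₂ T₂) v) :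
              ((Fin (M₂ + M₂) → v.adicCompletion (Fp L)) × (Fin (M₂ + M₂) → v.adicCompletion (Fp L))) ≃ₗ[v.adicCompletion (Fp L)]
                ((Fin (M₂ + M₂) → v.adicCompletion (Fp L)) × (Fin (M₂ + M₂) → v.adicCompletion (Fp L)))).symm (z₂, 0)).2) := by
  -- `E′⁻¹ w₀ = E′.symm w₀`; flip to `w₀ = E′ (…)` and compute `E′` forwards (★ (C3-c)'s script, second block now at `z₂`)
  dsimp only [LocalSplitting.toLin]
  rw [LinearEquiv.coe_coe, Subgroup.coe_inv, LinearEquiv.coe_inv, LinearEquiv.symm_apply_eq]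
  simp only [proj_frameMp, proj_boxLoc, frameSp, symplecticConj_apply, LinearEquiv.symm_apply_apply]
  simp only [Subgroup.coe_mul, LinearEquiv.mul_apply, coe_spInl, coe_spInr, inrW_apply_glue, inlW_apply_glue, map_zero, Prod.mk.eta,
    LinearEquiv.apply_symm_apply, glue_zero, frameW_apply]

set_option maxHeartbeats 400000 in -- MEASURED 2026-09-05: 200 000 ✗ (`isDefEq` in the first `rw`), 400 000 ✓
/-- **(S2) ★ THE HEAD: `e_D⁻¹ (E′⁻¹ (PD · (z₁ ⊔ z₂), 0)) = adblV b`, `b` EXPLICIT, AT THE NORMALISED PAIR.**  With ★ (C2b′)∕(C3-c)'s frame letters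
(block permutation `σ`, `P = σ.toPEquiv.toMatrix` (`hPσ`), `Pᵀ · gramR(𝕍 ⊗ V′) · P = T₁ ⊕ᶠ T₂` (`hP`), `PD = P ⊕ P` (`hPD`)) and the NORMALISED pair of
ruling (N) — `π(pᵢ) = transportSp 𝕋ᵢ (m(Aᵢ) · κᵢ)`, `κᵢ` the Cayley matrix re-indexed by `e₂ ⊕ e₂` (`hKᵢ`), `Aᵢ⁻¹ = 2·1 ⊕ Tᵢ` along `e₂` (`hAᵢ`), `hpᵢ` — for
EVERY `z₁ z₂`:  `e_D⁻¹ (E′⁻¹ (PD · (z₁ ⊔ z₂), 0)) = adblV (k ↦ (R z₁ ⊔ R z₂) (σ k))`, `R z l = ι_v(z (e₂ (inl l))) + ι_v(z (e₂ (inr l))) · δ̂` the PLAIN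
reading — (S1), ★ p865154 `transportSp_levi_mul_cayley_symm_apply` (the `Tᵢ` cancel), §1 `eD_symm_frameW_pd` ⊕ `eD_symm_glue` ⊕ `eD_symm_antidiag`, and
`σ.toPEquiv.toMatrix *ᵥ w = w ∘ σ`.  Its `halfDiff` is ★ (C3-c) `exists_pointReading`'s row reading (now on BOTH rows), its `halfSum` vanishes.
[cite: Kudla1994, §2, §3 Thm. 3.1] [cite: MoeglinVignerasWaldspurger1987, Chap. 2 II.1 Rem. (6), II Remarque (3)] [cite: HarrisKudlaSweet1996, §1 (1.11)] [cite: Weil1964, n° 34] -/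
theorem eD_symm_toLin_inv_frameMp_boxLoc_apply_glue {σ : Equiv.Perm (Fin (M₂ + M₂))}
    {T₁ T₂ : Matrix (Fin M₂) (Fin M₂) (Fp L)}
    (P : GL (Fin (M₂ + M₂)) (Fp L)) (hPσ : (P : Matrix (Fin (M₂ + M₂)) (Fin (M₂ + M₂)) (Fp L)) = σ.toPEquiv.toMatrix)
    (hP : ((P : Matrix (Fin (M₂ + M₂)) (Fin (M₂ + M₂)) (Fp L)))ᵀ *
        gramR L e' dV hdV (tensorFrame L dW eW dV') (tensorFrame_real L dW hdW eW dV' hdV') * (P : Matrix _ _ (Fp L)) =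
      UnitaryGroup.finSum M₂ M₂ T₁ T₂)
    {PD : GL (Fin ((M₂ + M₂) + (M₂ + M₂))) (Fp L)} (hPD : PD = UnitaryGroup.reindexGL (e₂ (M₂ + M₂)) (UnitaryGroup.blockDiagGL (P, P)))
    -- the normalised pair (ruling (N); ★ p865154's letters, block `1` and block `2`)
    (hTv₁ : IsUnit (localGram (Fp L) (M₂ + M₂) (LocalSplitting.gramD (Fp L) M₂ T₁) v).det)
    (K₁ : Matrix.symplecticGroup (Fin (M₂ + M₂)) (v.adicCompletion (Fp L)))
    (hK₁ : (K₁ : Matrix (Fin (M₂ + M₂) ⊕ Fin (M₂ + M₂)) (Fin (M₂ + M₂) ⊕ Fin (M₂ + M₂)) (v.adicCompletion (Fp L))) =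
      Matrix.reindex ((e₂ M₂).sumCongr (e₂ M₂)) ((e₂ M₂).sumCongr (e₂ M₂))
        (Matrix.fromBlocks (Matrix.fromBlocks 1 (-1) 0 0)
            (Matrix.fromBlocks 0 0 ((⅟(2 : v.adicCompletion (Fp L))) • 1) ((⅟(2 : v.adicCompletion (Fp L))) • 1))
            (Matrix.fromBlocks 0 0 (-1) (-1))
            (Matrix.fromBlocks ((⅟(2 : v.adicCompletion (Fp L))) • 1) (-((⅟(2 : v.adicCompletion (Fp L))) • 1)) 0 0) :
          Matrix ((Fin M₂ ⊕ Fin M₂) ⊕ (Fin M₂ ⊕ Fin M₂)) ((Fin M₂ ⊕ Fin M₂) ⊕ (Fin M₂ ⊕ Fin M₂)) (v.adicCompletion (Fp L))))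
    (A₁ : GL (Fin (M₂ + M₂)) (v.adicCompletion (Fp L)))
    (hA₁ : ((A₁⁻¹ : GL (Fin (M₂ + M₂)) (v.adicCompletion (Fp L))) : Matrix (Fin (M₂ + M₂)) (Fin (M₂ + M₂)) (v.adicCompletion (Fp L))) =
      Matrix.reindex (e₂ M₂) (e₂ M₂) (Matrix.fromBlocks ((2 : v.adicCompletion (Fp L)) • 1) 0 0 (localGram (Fp L) M₂ T₁ v)))
    (p₁ : LocalMp (Fp L) (M₂ + M₂) (gramD (Fp L) M₂ T₁) v)
    (hp₁ : MpPsi.proj _ p₁ = transportSp (localGram (Fp L) (M₂ + M₂) (LocalSplitting.gramD (Fp L) M₂ T₁) v) hTv₁ (levi A₁ * K₁))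
    (hTv₂ : IsUnit (localGram (Fp L) (M₂ + M₂) (LocalSplitting.gramD (Fp L) M₂ T₂) v).det)
    (K₂ : Matrix.symplecticGroup (Fin (M₂ + M₂)) (v.adicCompletion (Fp L)))
    (hK₂ : (K₂ : Matrix (Fin (M₂ + M₂) ⊕ Fin (M₂ + M₂)) (Fin (M₂ + M₂) ⊕ Fin (M₂ + M₂)) (v.adicCompletion (Fp L))) =
      Matrix.reindex ((e₂ M₂).sumCongr (e₂ M₂)) ((e₂ M₂).sumCongr (e₂ M₂))
        (Matrix.fromBlocks (Matrix.fromBlocks 1 (-1) 0 0)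
            (Matrix.fromBlocks 0 0 ((⅟(2 : v.adicCompletion (Fp L))) • 1) ((⅟(2 : v.adicCompletion (Fp L))) • 1))
            (Matrix.fromBlocks 0 0 (-1) (-1))
            (Matrix.fromBlocks ((⅟(2 : v.adicCompletion (Fp L))) • 1) (-((⅟(2 : v.adicCompletion (Fp L))) • 1)) 0 0) :
          Matrix ((Fin M₂ ⊕ Fin M₂) ⊕ (Fin M₂ ⊕ Fin M₂)) ((Fin M₂ ⊕ Fin M₂) ⊕ (Fin M₂ ⊕ Fin M₂)) (v.adicCompletion (Fp L))))
    (A₂ : GL (Fin (M₂ + M₂)) (v.adicCompletion (Fp L)))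
    (hA₂ : ((A₂⁻¹ : GL (Fin (M₂ + M₂)) (v.adicCompletion (Fp L))) : Matrix (Fin (M₂ + M₂)) (Fin (M₂ + M₂)) (v.adicCompletion (Fp L))) =
      Matrix.reindex (e₂ M₂) (e₂ M₂) (Matrix.fromBlocks ((2 : v.adicCompletion (Fp L)) • 1) 0 0 (localGram (Fp L) M₂ T₂ v)))
    (p₂ : LocalMp (Fp L) (M₂ + M₂) (gramD (Fp L) M₂ T₂) v)
    (hp₂ : MpPsi.proj _ p₂ = transportSp (localGram (Fp L) (M₂ + M₂) (LocalSplitting.gramD (Fp L) M₂ T₂) v) hTv₂ (levi A₂ * K₂))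
    (z₁ z₂ : Fin (M₂ + M₂) → v.adicCompletion (Fp L)) :
    (eD (Fp L) L (IsCMField.complexConj L) (complexConj_imagUnit L) (imagUnit_ne_zero L) (imagUnit_mul_self L) v (M₂ + M₂)).symm
        (toLin (Fp L) v (MpPsi.proj _ (frameMp (Fp L) v ((M₂ + M₂) + (M₂ + M₂)) PD (transpose_pd_mul_gramD_mul_pd (Fp L) (M₂ + M₂) P hP hPD)
            (boxLoc (Fp L) v M₂ M₂ (T₁ := T₁) (T₂ := T₂) (p₁, p₂))))⁻¹
          (frameLin (Fp L) v ((M₂ + M₂) + (M₂ + M₂)) PD (glue (blkIdx M₂ M₂) z₁ z₂), 0)) =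
      adblV fun k => glue finSumFinEquiv
        (fun l => UnitaryGroup.toLocalRing L v (z₁ (e₂ M₂ (Sum.inl l))) +
          UnitaryGroup.toLocalRing L v (z₁ (e₂ M₂ (Sum.inr l))) * algebraMap L (LocalRing L v) (imagUnit L))
        (fun l => UnitaryGroup.toLocalRing L v (z₂ (e₂ M₂ (Sum.inl l))) +
          UnitaryGroup.toLocalRing L v (z₂ (e₂ M₂ (Sum.inr l))) * algebraMap L (LocalRing L v) (imagUnit L)) (σ k) := by
  rw [toLin_inv_frameMp_boxLoc_apply_glue L dV hdV dW hdW eW e' dV' hdV' v P hP hPD p₁ p₂ z₁ z₂, hp₁, hp₂,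
    transportSp_levi_mul_cayley_symm_apply (Fp L) v M₂ hTv₁ K₁ hK₁ A₁ hA₁ z₁,
    transportSp_levi_mul_cayley_symm_apply (Fp L) v M₂ hTv₂ K₂ hK₂ A₂ hA₂ z₂,
    eD_symm_frameW_pd (Fp L) L (IsCMField.complexConj L) (complexConj_imagUnit L) (imagUnit_ne_zero L) (imagUnit_mul_self L) v (M₂ + M₂) P hPD,
    eD_symm_glue (Fp L) L (IsCMField.complexConj L) (complexConj_imagUnit L) (imagUnit_ne_zero L) (imagUnit_mul_self L) v M₂ M₂,
    eD_symm_antidiag (Fp L) L (IsCMField.complexConj L) (complexConj_imagUnit L) (imagUnit_ne_zero L) (imagUnit_mul_self L) v M₂ z₁,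
    eD_symm_antidiag (Fp L) L (IsCMField.complexConj L) (complexConj_imagUnit L) (imagUnit_ne_zero L) (imagUnit_mul_self L) v M₂ z₂,
    hPσ, PEquiv.map_toMatrix, PEquiv.toMatrix_toPEquiv_mulVec, PEquiv.toMatrix_toPEquiv_mulVec]
  funext s
  rcases s with k | k
  · simp only [adblV, Sum.elim_inl, Sum.elim_inr, Function.comp_apply]
  · simp only [adblV, Sum.elim_inl, Sum.elim_inr, Function.comp_apply, Pi.neg_apply, glue_neg]

/-- **THE ROW READING OF `b`**: along the block lines `σ (epsV (i₀, l)) = inl l`, `σ (epsV (i₁, l)) = inr l` (`hσ₀ hσ₁`),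
`(R z₁ ⊔ R z₂) (σ (epsV (j, l))) = if j = i₀ then R z₁ l else R z₂ l` — row `i₀` reads `z₁`, row `i₁` reads `z₂` (★ (C3-c) `exists_pointReading` is `z₂ = 0`).
[cite: Kudla1994, §2] [cite: HarrisKudlaSweet1996, §1 (1.11)] -/
theorem glue_apply_sigma_epsV {i₀ i₁ : Fin 2} (hi : i₀ ≠ i₁) {σ : Equiv.Perm (Fin (M₂ + M₂))}
    (hσ₀ : ∀ k, σ (epsV e eW e' (i₀, k)) = finSumFinEquiv (Sum.inl k)) (hσ₁ : ∀ k, σ (epsV e eW e' (i₁, k)) = finSumFinEquiv (Sum.inr k))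
    {X : Type*} (R₁ R₂ : Fin M₂ → X) (j : Fin 2) (l : Fin M₂) :
    glue finSumFinEquiv R₁ R₂ (σ (epsV e eW e' (j, l))) = if j = i₀ then R₁ l else R₂ l := by
  by_cases hj : j = i₀
  · rw [if_pos hj, hj, hσ₀, glue_apply_inl]
  · have hj1 : j = i₁ := by omega
    rw [if_neg hj, hj1, hσ₁, glue_apply_inr]

end Tensor

end Summit.HodgeConjecture.HodgeConjecture.Cruxes.HLiu418.K2LiuConeGraphReadingPointTwoBlock

end
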